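import Summits.AtomisticToContinuum.FouriersLaw.Theorems.EmbeddedDrudeMourreMourreDissolutionOfKineticCorner
import Summits.AtomisticToContinuum.FouriersLaw.Theorems.EmbeddedDrudeMourreDrudeDissolutionStubBmRigidity
import HarnessLib

/-!
# The two kinetic children of `DrudeDissolution` are statements about ONE function:
# `∃`-form ⇔ `∀`-form over the Buttà–Marchioro class

Helper file for crux `stmt-AtomisticToContinuum-12593` (`EmbeddedDrudeMourre.DrudeDissolution`), line
`canonical-kinetic-cut` ≡ `Sketch` rev 12 (lead c15, 2026-08-17), `--supports` only.

The registered stubs PKT∃ `stub_bmPostKineticTail` and KL∃ `stub_bmKineticLimit` (= split children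
`BmPostKineticTail` / `BmKineticLimit`, `Cruxes/DrudeDissolution/SPLIT-READY.md`) ask, at each small `T`, for
SOME pair `(μ, D)` in the BUTTÀ–MARCHIORO CLASS — `μ` DLR at `T` and invariant under the unit shift, `D` an
infinite-volume dynamics with `D.carrier = bmGood` preserving `μ` — whose summed current autocorrelation
`C = D.currentCorrelation μ` has a property (`L¹` tail bound, resp. window value). Two landed facts make the
existential quantifier immaterial:

* RIGIDITY (`LineSketch.stub_bmRigidity`, p127446): two BM-class pairs at the same `T > 0` have the same state,
  the same flow on `bmGood`, and the SAME `C` at every time;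
* EXISTENCE (`MourreDissolution.canonicalDatum` + `goodTriple_of_canonicalDatum`, p121356): for every `T > 0`
  the canonical symmetric Buttà–Marchioro dynamics with its shift-invariant DLR state IS a BM-class pair.

Hence (§1) for `ω₂, lam, β, γ > 0`, `T > 0` and ANY predicate `Φ` on functions `ℝ → ℝ`:
`(∃ BM-class pair with Φ C) ↔ (∀ BM-class pairs, Φ C)` (`exists_bmClass_iff_forall`), and (§2) both children,
with the four parameters fixed, are equivalent to their UNIVERSAL forms (`bmPostKineticTail_iff_forall`,
`bmKineticLimit_iff_forall`): a disprover refutes child 1 by exhibiting far-tail mass for ANY convenient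
BM-class pair (e.g. the canonical one MD simulates), a prover proves it for whichever BM-class pair it
constructs. Tree vocabulary only; Mathlib + the two imported Theorems files.
-/

noncomputable section

open MeasureTheory Filter Set Function
open Literature.MathematicalPhysics.KineticTheory.HeatConduction

namespace Summit.AtomisticToContinuum.FouriersLaw.Theorems.DrudeDissolution.ChildrenRigidity

/-- The BUTTÀ–MARCHIORO CLASS predicate on a pair `(μ, D)` of `pinnedChain ω₂ lam β γ` at temperature `T`:
DLR at `T`, unit-shift invariant, `D.carrier = bmGood`, `μ`-preserving — spelled inline everywhere below; this
lemma only records that the canonical datum supplies a member for every `T > 0`.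
[cite: ButtaMarchioro2016, Thm 2.1] -/
theorem exists_bmClass {ω₂ lam β γ : ℝ} (hω : 0 < ω₂) (hl : 0 < lam) (hβ : 0 < β) {T : ℝ} (hT : 0 < T) :
    ∃ (μ : Measure ChainConfig) (D : InfiniteChainDynamics (pinnedChain ω₂ lam β γ)),
      (pinnedChain ω₂ lam β γ).IsChainGibbsMeasure T μ ∧
      MeasurePreserving (fun σ : ChainConfig => fun i : ℤ => σ (i + 1)) μ μ ∧
      D.carrier = (pinnedChain ω₂ lam β γ).bmGood ∧ D.PreservesMeasure μ := by
  obtain ⟨D, hD, hsh, hZ⟩ := MourreDissolution.canonicalDatum ω₂ lam β γ hω hl hβ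
  obtain ⟨Z, hG, -, -, hsc⟩ := hZ T hT
  obtain ⟨hG', hP, -, -, hshift, -⟩ := MourreDissolution.goodTriple_of_canonicalDatum hsh Z hG hsc
  exact ⟨Z.μ, D, hG', hshift, hD, hP⟩

/-- **RIGIDITY OF `C` IN THE BM CLASS** (repackaged `LineSketch.stub_bmRigidity`): two BM-class pairs at the
same `T > 0` have the same summed current autocorrelation, as functions. [folklore] -/
theorem currentCorrelation_eq_of_bmClass {ω₂ lam β γ : ℝ} (hω : 0 < ω₂) (hl : 0 < lam) (hβ : 0 < β)
    (hγ : 0 < γ) {T : ℝ} (hT : 0 < T)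
    {μ₁ μ₂ : Measure ChainConfig} {D₁ D₂ : InfiniteChainDynamics (pinnedChain ω₂ lam β γ)}
    (hG₁ : (pinnedChain ω₂ lam β γ).IsChainGibbsMeasure T μ₁)
    (hS₁ : MeasurePreserving (fun σ : ChainConfig => fun i : ℤ => σ (i + 1)) μ₁ μ₁)
    (hD₁ : D₁.carrier = (pinnedChain ω₂ lam β γ).bmGood) (hP₁ : D₁.PreservesMeasure μ₁)
    (hG₂ : (pinnedChain ω₂ lam β γ).IsChainGibbsMeasure T μ₂)
    (hS₂ : MeasurePreserving (fun σ : ChainConfig => fun i : ℤ => σ (i + 1)) μ₂ μ₂)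
    (hD₂ : D₂.carrier = (pinnedChain ω₂ lam β γ).bmGood) :
    D₁.currentCorrelation μ₁ = D₂.currentCorrelation μ₂ :=
  funext (LineSketch.stub_bmRigidity ω₂ lam β γ hω hl hβ hγ T μ₁ μ₂ D₁ D₂ hT hG₁ hG₂ hS₁ hS₂ hD₁ hD₂
    hP₁).2.2

/-! ## §1 `∃`-form ⇔ `∀`-form for any clause on `C` -/

/-- **ONE FUNCTION.** For `ω₂, lam, β, γ > 0`, `T > 0` and any predicate `Φ` on `ℝ → ℝ`: SOME BM-class pair at
`T` has `Φ C` iff EVERY BM-class pair at `T` has `Φ C` (rigidity + existence of the canonical datum).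
[folklore] -/
theorem exists_bmClass_iff_forall {ω₂ lam β γ : ℝ} (hω : 0 < ω₂) (hl : 0 < lam) (hβ : 0 < β)
    (hγ : 0 < γ) {T : ℝ} (hT : 0 < T) (Φ : (ℝ → ℝ) → Prop) :
    (∃ (μ : Measure ChainConfig) (D : InfiniteChainDynamics (pinnedChain ω₂ lam β γ)),
      (pinnedChain ω₂ lam β γ).IsChainGibbsMeasure T μ ∧
      MeasurePreserving (fun σ : ChainConfig => fun i : ℤ => σ (i + 1)) μ μ ∧
      D.carrier = (pinnedChain ω₂ lam β γ).bmGood ∧ D.PreservesMeasure μ ∧ Φ (D.currentCorrelation μ)) ↔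
    (∀ (μ : Measure ChainConfig) (D : InfiniteChainDynamics (pinnedChain ω₂ lam β γ)),
      (pinnedChain ω₂ lam β γ).IsChainGibbsMeasure T μ →
      MeasurePreserving (fun σ : ChainConfig => fun i : ℤ => σ (i + 1)) μ μ →
      D.carrier = (pinnedChain ω₂ lam β γ).bmGood → D.PreservesMeasure μ → Φ (D.currentCorrelation μ)) := by
  constructor
  · rintro ⟨μ₁, D₁, hG₁, hS₁, hD₁, hP₁, hΦ⟩ μ₂ D₂ hG₂ hS₂ hD₂ _
    rwa [← currentCorrelation_eq_of_bmClass hω hl hβ hγ hT hG₁ hS₁ hD₁ hP₁ hG₂ hS₂ hD₂]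
  · intro h
    obtain ⟨μ, D, hG, hS, hD, hP⟩ := exists_bmClass hω hl hβ (γ := γ) hT
    exact ⟨μ, D, hG, hS, hD, hP, h μ D hG hS hD hP⟩

/-! ## §2 The two children in universal form -/

/-- **CHILD 1 (`BmPostKineticTail`) AT `(ω₂, lam, β, γ)` ⇔ ITS UNIVERSAL FORM**: the post-kinetic tail statement
in existential Buttà–Marchioro form (registered stub `stub_bmPostKineticTail` with the parameters fixed) is
equivalent to the same statement for EVERY BM-class pair — by rigidity it is a statement about the one
function `C_T`. [folklore] -/
theorem bmPostKineticTail_iff_forall_of_pos {ω₂ lam β γ : ℝ} (hω : 0 < ω₂) (hl : 0 < lam) (hβ : 0 < β)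
    (hγ : 0 < γ) :
    (∀ e : ℝ, 0 < e → ∃ M T₀ : ℝ, 0 < M ∧ 0 < T₀ ∧ ∀ T : ℝ, 0 < T → T < T₀ →
      ∃ (μ : Measure ChainConfig) (D : InfiniteChainDynamics (pinnedChain ω₂ lam β γ)),
        (pinnedChain ω₂ lam β γ).IsChainGibbsMeasure T μ ∧
        MeasurePreserving (fun σ : ChainConfig => fun i : ℤ => σ (i + 1)) μ μ ∧
        D.carrier = (pinnedChain ω₂ lam β γ).bmGood ∧ D.PreservesMeasure μ ∧
        IntegrableOn (D.currentCorrelation μ) (Ioi (M / T ^ 2)) ∧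
        ∫ t in Ioi (M / T ^ 2), |D.currentCorrelation μ t| ≤ e) ↔
    (∀ e : ℝ, 0 < e → ∃ M T₀ : ℝ, 0 < M ∧ 0 < T₀ ∧ ∀ T : ℝ, 0 < T → T < T₀ →
      ∀ (μ : Measure ChainConfig) (D : InfiniteChainDynamics (pinnedChain ω₂ lam β γ)),
        (pinnedChain ω₂ lam β γ).IsChainGibbsMeasure T μ →
        MeasurePreserving (fun σ : ChainConfig => fun i : ℤ => σ (i + 1)) μ μ →
        D.carrier = (pinnedChain ω₂ lam β γ).bmGood → D.PreservesMeasure μ →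
        IntegrableOn (D.currentCorrelation μ) (Ioi (M / T ^ 2)) ∧
        ∫ t in Ioi (M / T ^ 2), |D.currentCorrelation μ t| ≤ e) := by
  refine forall_congr' fun e => forall_congr' fun _ => exists_congr fun M =>
    exists_congr fun T₀ => and_congr_right fun _ => and_congr_right fun _ =>
    forall_congr' fun T => forall_congr' fun hT => forall_congr' fun _ => ?_
  exact exists_bmClass_iff_forall hω hl hβ hγ hT
    (fun C => IntegrableOn C (Ioi (M / T ^ 2)) ∧ ∫ t in Ioi (M / T ^ 2), |C t| ≤ e)

/-- **CHILD 1 ⇔ ITS UNIVERSAL FORM — registered sub-goal form** (closed; fully qualified; the signature registered on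
stmt-AtomisticToContinuum-12593 as `bmPostKineticTail_iff_forall`). [folklore] -/
theorem bmPostKineticTail_iff_forall : ∀ ω₂ lam β γ : ℝ, 0 < ω₂ → 0 < lam → 0 < β → 0 < γ → ((∀ e : ℝ, 0 < e → ∃ M T₀ : ℝ, 0 < M ∧ 0 < T₀ ∧ ∀ T : ℝ, 0 < T → T < T₀ → ∃ (μ : MeasureTheory.Measure Literature.MathematicalPhysics.KineticTheory.HeatConduction.ChainConfig) (D : Literature.MathematicalPhysics.KineticTheory.HeatConduction.InfiniteChainDynamics (Literature.MathematicalPhysics.KineticTheory.HeatConduction.pinnedChain ω₂ lam β γ)), (Literature.MathematicalPhysics.KineticTheory.HeatConduction.pinnedChain ω₂ lam β γ).IsChainGibbsMeasure T μ ∧ MeasureTheory.MeasurePreserving (fun σ : Literature.MathematicalPhysics.KineticTheory.HeatConduction.ChainConfig => fun i : ℤ => σ (i + 1)) μ μ ∧ D.carrier = (Literature.MathematicalPhysics.KineticTheory.HeatConduction.pinnedChain ω₂ lam β γ).bmGood ∧ D.PreservesMeasure μ ∧ MeasureTheory.IntegrableOn (D.currentCorrelation μ) (Set.Ioi (M / T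 ^ 2)) ∧ ∫ t in Set.Ioi (M / T ^ 2), |D.currentCorrelation μ t| ≤ e) ↔ (∀ e : ℝ, 0 < e → ∃ M T₀ : ℝ, 0 < M ∧ 0 < T₀ ∧ ∀ T : ℝ, 0 < T → T < T₀ → ∀ (μ : MeasureTheory.Measure Literature.MathematicalPhysics.KineticTheory.HeatConduction.ChainConfig) (D : Literature.MathematicalPhysics.KineticTheory.HeatConduction.InfiniteChainDynamics (Literature.MathematicalPhysics.KineticTheory.HeatConduction.pinnedChain ω₂ lam β γ)), (Literature.MathematicalPhysics.KineticTheory.HeatConduction.pinnedChain ω₂ lam β γ).IsChainGibbsMeasure T μ → MeasureTheory.MeasurePreserving (fun σ : Literature.MathematicalPhysics.KineticTheory.HeatConduction.ChainConfig => fun i : ℤ => σ (i + 1)) μ μ → D.carrier = (Literature.MathematicalPhysics.KineticTheory.HeatConduction.pinnedChain ω₂ lam β γ).bmGood → D.PreservesMeasure μ → MeasureTheory.IntegrableOn (D.currentCorrelation μ) (Set.Ioi (M / T ^ 2)) ∧ ∫ t in Set.Ioi (M / T ^ 2), |D.currentCorrelation μ t| ≤ e)) :=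
  fun _ _ _ _ hω hl hβ hγ => bmPostKineticTail_iff_forall_of_pos hω hl hβ hγ

/-- **CHILD 2 (`BmKineticLimit`) AT `(ω₂, lam, β, γ)` ⇔ ITS UNIVERSAL FORM**: the kinetic-window statement in
existential Buttà–Marchioro form (registered stub `stub_bmKineticLimit` with the parameters fixed) is equivalent
to the same statement for EVERY BM-class pair (same kernel `K`). [folklore] -/
theorem bmKineticLimit_iff_forall {ω₂ lam β γ : ℝ} (hω : 0 < ω₂) (hl : 0 < lam) (hβ : 0 < β)
    (hγ : 0 < γ) :
    (∃ K : ℝ → ℝ, IntegrableOn K (Ioi 0) ∧ 0 < ∫ τ in Ioi 0, K τ ∧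
      ∀ δ M e : ℝ, 0 < δ → δ ≤ M → 0 < e → ∃ T₀ : ℝ, 0 < T₀ ∧ ∀ T : ℝ, 0 < T → T < T₀ →
        ∃ (μ : Measure ChainConfig) (D : InfiniteChainDynamics (pinnedChain ω₂ lam β γ)),
          (pinnedChain ω₂ lam β γ).IsChainGibbsMeasure T μ ∧
          MeasurePreserving (fun σ : ChainConfig => fun i : ℤ => σ (i + 1)) μ μ ∧
          D.carrier = (pinnedChain ω₂ lam β γ).bmGood ∧ D.PreservesMeasure μ ∧
          |(∫ t in (δ / T ^ 2)..(M / T ^ 2), D.currentCorrelation μ t) - ∫ τ in δ..M, K τ| ≤ e) ↔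
    (∃ K : ℝ → ℝ, IntegrableOn K (Ioi 0) ∧ 0 < ∫ τ in Ioi 0, K τ ∧
      ∀ δ M e : ℝ, 0 < δ → δ ≤ M → 0 < e → ∃ T₀ : ℝ, 0 < T₀ ∧ ∀ T : ℝ, 0 < T → T < T₀ →
        ∀ (μ : Measure ChainConfig) (D : InfiniteChainDynamics (pinnedChain ω₂ lam β γ)),
          (pinnedChain ω₂ lam β γ).IsChainGibbsMeasure T μ →
          MeasurePreserving (fun σ : ChainConfig => fun i : ℤ => σ (i + 1)) μ μ →
          D.carrier = (pinnedChain ω₂ lam β γ).bmGood → D.PreservesMeasure μ →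
          |(∫ t in (δ / T ^ 2)..(M / T ^ 2), D.currentCorrelation μ t) - ∫ τ in δ..M, K τ| ≤ e) := by
  refine exists_congr fun K => and_congr_right fun _ => and_congr_right fun _ =>
    forall₃_congr fun δ M e => forall_congr' fun _ => forall_congr' fun _ => forall_congr' fun _ =>
    exists_congr fun T₀ => and_congr_right fun _ =>
    forall_congr' fun T => forall_congr' fun hT => forall_congr' fun _ => ?_
  exact exists_bmClass_iff_forall hω hl hβ hγ hT
    (fun C => |(∫ t in (δ / T ^ 2)..(M / T ^ 2), C t) - ∫ τ in δ..M, K τ| ≤ e)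

/-- **REFUTATION SHAPE OF CHILD 1** (for the disprover; contrapositive bookkeeping of the universal form): if for
some `e > 0` and EVERY `M, T₀ > 0` there is a temperature `T ∈ (0, T₀)` and SOME BM-class pair at `T` whose `C`
is either not integrable on `(M T⁻², ∞)` or has `∫_{MT⁻²}^∞ |C| > e`, then child 1 fails at `(ω₂, lam, β, γ)`.
[folklore] -/
theorem not_bmPostKineticTail_of_witnesses {ω₂ lam β γ : ℝ} (hω : 0 < ω₂) (hl : 0 < lam) (hβ : 0 < β)
    (hγ : 0 < γ) {e : ℝ} (he : 0 < e)
    (h : ∀ M T₀ : ℝ, 0 < M → 0 < T₀ → ∃ T : ℝ, 0 < T ∧ T < T₀ ∧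
      ∃ (μ : Measure ChainConfig) (D : InfiniteChainDynamics (pinnedChain ω₂ lam β γ)),
        (pinnedChain ω₂ lam β γ).IsChainGibbsMeasure T μ ∧
        MeasurePreserving (fun σ : ChainConfig => fun i : ℤ => σ (i + 1)) μ μ ∧
        D.carrier = (pinnedChain ω₂ lam β γ).bmGood ∧ D.PreservesMeasure μ ∧
        (IntegrableOn (D.currentCorrelation μ) (Ioi (M / T ^ 2)) →
          e < ∫ t in Ioi (M / T ^ 2), |D.currentCorrelation μ t|)) :
    ¬ (∀ e : ℝ, 0 < e → ∃ M T₀ : ℝ, 0 < M ∧ 0 < T₀ ∧ ∀ T : ℝ, 0 < T → T < T₀ →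
      ∃ (μ : Measure ChainConfig) (D : InfiniteChainDynamics (pinnedChain ω₂ lam β γ)),
        (pinnedChain ω₂ lam β γ).IsChainGibbsMeasure T μ ∧
        MeasurePreserving (fun σ : ChainConfig => fun i : ℤ => σ (i + 1)) μ μ ∧
        D.carrier = (pinnedChain ω₂ lam β γ).bmGood ∧ D.PreservesMeasure μ ∧
        IntegrableOn (D.currentCorrelation μ) (Ioi (M / T ^ 2)) ∧
        ∫ t in Ioi (M / T ^ 2), |D.currentCorrelation μ t| ≤ e) := by
  intro hPKT
  rw [bmPostKineticTail_iff_forall_of_pos hω hl hβ hγ] at hPKT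
  obtain ⟨M, T₀, hM, hT₀, hall⟩ := hPKT e he
  obtain ⟨T, hT, hTT₀, μ, D, hG, hS, hD, hP, hbad⟩ := h M T₀ hM hT₀
  obtain ⟨hint, hle⟩ := hall T hT hTT₀ μ D hG hS hD hP
  exact absurd hle (not_le.mpr (hbad hint))

end Summit.AtomisticToContinuum.FouriersLaw.Theorems.DrudeDissolution.ChildrenRigidity

end
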